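import Literature.NumberTheory.EllipticCurves.PAdicBSDSplitMultiplicativeProofs
import HarnessLib

/-!
# utd-idea g60 — typed shadow of the K1 decision (`universal-toric-half-order`, crux 24207)

Two PROVED structural lemmas (the only input of §4 of `K1-DECISION-utd-idea-g60.md`:
`a₃ = 0` ⇒ the Mazur–Tate projection `π_{m → m-1}(θ_m) = 0`) and ONE typed, data-backed
NEGATIVE conjecture (barrier note B-g60-1 «UniversalToricFamilyOrderOne», period form):
the additive (toric) period sums `G_u(ζ_{3^m}) = Σ_k [k/3^m]⁺ ζ^{uk}` have bounded
`3`-divisibility — order exactly `1`, not `m/2` — verified exactly on 14 rational newforms of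
level `135, 189, 162, 216, 243` (`m ≤ 6` on 135.A). Nothing here is a route item; no `sorry`.
-/

namespace Summit.BirchSwinnertonDyer.BirchSwinnertonDyer.Cruxes.RationalSplitIMCInclusionAtThree.UtdIdeaG60

open scoped MatrixGroups ModularForm
open CongruenceSubgroup
open Literature.NumberTheory.EllipticCurves Literature.NumberTheory.EllipticCurves.ModularForms

/-- `a₃(f) = 0` and `3 ∣ N` ⇒ the three-term relation `Σ_{j<3} {∞ → (r+j)/3}_f = 0`
(the `U₃`-relation `cuspCoeff_mul_modularSymbol_of_dvd` with eigenvalue `0`). -/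
theorem sum_modularSymbol_third_eq_zero {N : ℕ} [NeZero N] {f : CuspForm (Gamma0 N) 2}
    (hf : IsNewform0 f) (h3N : 3 ∣ N) (ha3 : cuspCoeff f 3 = 0) (r : ℚ) :
    ∑ j : Fin 3, modularSymbol f ((r + j) / 3) = 0 := by
  have h := cuspCoeff_mul_modularSymbol_of_dvd (p := 3) hf Nat.prime_three h3N r
  rw [ha3, zero_mul] at h
  exact h.symm

/-- **Mazur–Tate projection vanishing** at an additive prime: for `m ≥ 1` and every `a`,
`Σ_{s<3} {∞ → (a + s·3^{m-1})/3^m}_f = 0`, i.e. `π_{m→m-1}(θ_m(f)) = 0`, whence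
`θ_m ∈ ω_{m-2}·ℤ₃[G_m]` and the FORCED `v₃(χ(θ_m)) ≥ 1/2`, `λ(θ_m) ≥ 3^{m-2}`. -/
theorem mazurTate_projection_eq_zero {N : ℕ} [NeZero N] {f : CuspForm (Gamma0 N) 2}
    (hf : IsNewform0 f) (h3N : 3 ∣ N) (ha3 : cuspCoeff f 3 = 0) {m : ℕ} (hm : 1 ≤ m) (a : ℤ) :
    ∑ s : Fin 3, modularSymbol f (((a : ℚ) + s * 3 ^ (m - 1)) / 3 ^ m) = 0 := by
  have h := sum_modularSymbol_third_eq_zero hf h3N ha3 ((a : ℚ) / 3 ^ (m - 1))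
  have h3 : (3 : ℚ) ^ m = 3 ^ (m - 1) * 3 := by
    rw [← pow_succ]; congr 1; omega
  have key : ∀ s : Fin 3,
      ((a : ℚ) + s * 3 ^ (m - 1)) / 3 ^ m = ((a : ℚ) / 3 ^ (m - 1) + s) / 3 := by
    intro s
    rw [h3]
    field_simp
  simp_rw [key]
  exact h

/-- For the newform `f` of an elliptic `W` with `27 ∣ N = N_W`: `a₃(f) = 0`
(`IsNewformOf`: `a₃(f) = L(W)_3`), as a named hypothesis shape used below. -/
def CuspCoeffThreeVanishes {N : ℕ} [NeZero N] (W : WeierstrassCurve ℚ)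
    (f : CuspForm (Gamma0 N) 2) : Prop :=
  IsNewformOf W f → 27 ∣ N → cuspCoeff f 3 = 0

/-- **B-g60-1 (typed, period form; data-backed NEGATIVE conjecture, not an item).**
For the newform `f` of an elliptic curve of conductor `N` with `27 ∣ N`, write the plus symbols
as `[r]⁺ = q(r)·Ω` with `q : ℚ → ℤ` (any integral normalisation). Then the universal toric period
sums `G_u^{(m)}(ζ) = Σ_{k < 3^m} q(k/3^m) ζ^{uk}` (`ζ` a primitive `3^m`-th root of unity,
`u` a unit) have BOUNDED `3`-divisibility in `ℤ[ζ]`: there is `C` with, for all large `m`, some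
unit `u` such that `G_u^{(m)} ∉ 3^C·ℤ[ζ]`. Equivalently the universal toric vector `1_{1+3^mℤ₃}`
has index `3^{m - O(1)}` in `Hom(J_U, E) ⊗ ℤ₃` — ORDER EXACTLY ONE — which contradicts K1 of
`universal-toric-half-order` in its `Λ^{loc}` form (`index = 3^{m/2+O(1)}`). Evidence: exact
computation, `v_π(G_u) = φ(3^m)/2 + 1` for all `u`, `m = 2..6`, on 135.A; see the decision note. -/
def UniversalToricPeriodOrderOneAtThree : Prop :=
  ∀ (W : WeierstrassCurve ℚ) [W.IsElliptic] (N : ℕ) [NeZero N] (f : CuspForm (Gamma0 N) 2),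
    IsNewformOf W f → W.conductorNorm ℤ = N → 27 ∣ N →
    ∀ (Ω : ℝ) (q : ℚ → ℤ), (∀ r : ℚ, plusSymbol f r = (((q r : ℝ) * Ω : ℝ) : ℂ)) →
      (∃ r : ℚ, q r ≠ 0) →
      ∃ C m₀ : ℕ, ∀ m : ℕ, m₀ ≤ m → ∀ ζ : ℂ, IsPrimitiveRoot ζ (3 ^ m) →
        ∃ u : ℕ, u.Coprime 3 ∧
          (∑ k ∈ Finset.range (3 ^ m), (q ((k : ℚ) / 3 ^ m) : ℂ) * ζ ^ (u * k)) ∉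
            {z : ℂ | ∃ y ∈ Algebra.adjoin ℤ ({ζ} : Set ℂ), z = (3 : ℂ) ^ C * y}

/-- The `Λ^{loc}` form of K1 would force the opposite divisibility (HALF order): for every `C'`
and all large `m`, every `G_u^{(m)} ∈ 3^{⌊m/2⌋ - C'}·ℤ[ζ]`. Stated for contrast; numerically
false on 135.A (`m = 4, 5, 6` already need `⌊m/2⌋ - C' ≤ 0.52`). -/
def UniversalToricPeriodHalfOrderAtThree : Prop :=
  ∀ (W : WeierstrassCurve ℚ) [W.IsElliptic] (N : ℕ) [NeZero N] (f : CuspForm (Gamma0 N) 2),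
    IsNewformOf W f → W.conductorNorm ℤ = N → 27 ∣ N →
    ∀ (Ω : ℝ) (q : ℚ → ℤ), (∀ r : ℚ, plusSymbol f r = (((q r : ℝ) * Ω : ℝ) : ℂ)) →
      (∃ r : ℚ, q r ≠ 0) →
      ∃ C' m₀ : ℕ, ∀ m : ℕ, m₀ ≤ m → ∀ ζ : ℂ, IsPrimitiveRoot ζ (3 ^ m) →
        ∀ u : ℕ, u.Coprime 3 →
          (∑ k ∈ Finset.range (3 ^ m), (q ((k : ℚ) / 3 ^ m) : ℂ) * ζ ^ (u * k)) ∈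
            {z : ℂ | ∃ y ∈ Algebra.adjoin ℤ ({ζ} : Set ℂ), z = (3 : ℂ) ^ (m / 2 - C') * y}

end Summit.BirchSwinnertonDyer.BirchSwinnertonDyer.Cruxes.RationalSplitIMCInclusionAtThree.UtdIdeaG60
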